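import Literature.Computability.ImplicitComplexity.SoftProgramInterpretation

/-!
# `OracleRefusal` (stmt-PneNP-14658, route PneNP/LightLogic rev 9) — negative side: the parity programs

Crux-attack (refuter, 2026-08-16) on the REPAIRED admission test `OracleRefusal`: "no clique `c ⊆ D` that is finitary
for the finiteness structure GENERATED BY SYNTAX at `!ⁿS_m ⊸ B` (`c ∈ {⟦Π⟧}^⊥⊥`, `u ⊥ v ⇔ u ∩ v` finite) and obsessional
from some threshold `STADecides n m` a language of `EXP ∖ P`". Paper verdict (item evidence `EVIDENCE.md`):
refuted-substantive at `n = 0, m = 1` — for EVERY language `O` a sub-clique `c_O ⊆ ⟦Π₀⟧ ∪ ⟦Π₁⟧` of the interpretations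
of the two PARITY programs `Π_b = λs. s STEP^! b`, `STEP = λℓ y. ℓ I I (y 1 0)`, is obsessional from `1` and
`STADecides 0 1 c_O O`; any sub-clique of a finite union of generators is finitary for free. This file lands the
PROGRAM-SIDE half of that construction, kernel-checked; the word side needs the semantic generation lemma for data
derivations `⊢ w̲ : S₁` (not in the tree) and is NOT here. Nothing below asserts a Theses statement.

* §1 `synFinitary_of_subset_union`: sub-cliques of `⟦Π₀⟧ ∪ ⟦Π₁⟧` satisfy the finiteness hypothesis of the crux
  (stated with the hypothesis expanded verbatim; no `def : Prop` is vendored here).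
* §2 the programs as DERIVATIONS `Parity.STEPD ▹ ⊢ STEP : B ⊸ B ⊸ B` (degree 0) and
  `Parity.progD Db ▹ ⊢ λs. s STEP b : S₁ ⊸ B = progTy 0 1` (degree 1, rank 0): level-1 deterministic programs, i.e.
  generators of the structure, with interpretations obsessional from `1` (`obsessionalFrom_one_prog`).
* §3 the runs the table uses (LTdF Def. 12 clauses of `STA.Deriv.interp`): on a genuine letter `STEP` maps an
  accumulator point ONE LAYER AROUND `r` to `r` — "`⟦NOT⟧` peels one layer in `REL`" (`step_run`, `step_tower_*`): this is
  what makes the word rows of `Π_b` rigid (chain labels form a tower of strict subterms) and puts the OUTPUT at the core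
  of the key; and `⟦Π_b⟧ ∋ ![(!M)‾ ⅋ (B̄₀ ⅋ r)]‾ ⅋ r` for every box `M` of lifted `STEP`-results and EVERY `r` (`prog_row_mem`).
* §4 the answer cliques `⟦0⟧`, `⟦1⟧` are closed under every action of threshold `≥ 1`.
-/

namespace Summit.PneNP.PneNP.Theorems.OracleRefusal.Negative

open Literature.Computability.ImplicitComplexity
open Literature.Computability.ImplicitComplexity.STA
open Literature.Computability.ImplicitComplexity.URel

/-! ## §1 The finiteness hypothesis is free on sub-cliques of finitely many generators -/

/-- **Every sub-clique of the union of two generator interpretations is finitary** for the finiteness structure on `D`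
generated by the interpretations of the closed sum-free programs of type `!ⁿ S_m ⊸ B` (the hypothesis of the crux
`OracleRefusal`, rev 9, expanded verbatim): it constrains nothing inside `⟦Π₀⟧ ∪ ⟦Π₁⟧`. [folklore] -/
theorem synFinitary_of_subset_union {n m d₀ d₁ : ℕ} {M₀ M₁ : Term}
    (D₀ : Deriv d₀ Ctx.empty M₀ (progTy n m)) (D₁ : Deriv d₁ Ctx.empty M₁ (progTy n m))
    (h₀ : M₀.SumFree) (h₁ : M₁.SumFree) {c : Set Point}
    (hc : c ⊆ SoftProgramInterpretation D₀ ∪ SoftProgramInterpretation D₁) :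
    ∀ u : Set Point, (∀ (d : ℕ) (M : Term) (D : Deriv d Ctx.empty M (progTy n m)),
      M.SumFree → (u ∩ SoftProgramInterpretation D).Finite) → (u ∩ c).Finite := by
  intro u hu
  refine Set.Finite.subset ((hu d₀ M₀ D₀ h₀).union (hu d₁ M₁ D₁ h₁)) fun x hx => ?_
  rcases hc hx.2 with h | h
  · exact Or.inl ⟨hx.1, h⟩
  · exact Or.inr ⟨hx.1, h⟩

/-! ## §2 The parity programs as derivations -/

namespace Parity

/-- `I = λu.u`. [cite: GaboardiMarionRonchidellarocca2008, §3.2] -/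
def I : Term := .lam (.var 0)

/-- `STEP = λℓ.λy. ℓ I I (y 1 0)`: read the letter (`ℓ I I = I` on both booleans), negate the accumulator
(`y 1 0 = NOT y`). [folklore] -/
def STEP : Term := .lam (.lam (.app (.app (.app (.var 1) I) I) (.app (.app (.var 0) one) zero)))

/-- `prog b = λs. s STEP b`; `prog b w̲ →β* NOT^{|w|} b` decides the parity of `|w|`. [folklore] -/
def prog (b : Term) : Term := .lam (.app (.app (.var 0) STEP) b)

/-- `B ⊸ B`. [folklore] -/
def BB : LinTy := .limp 0 tyB tyB

/-- `B ⊸ B ⊸ B` (the step type `B ⊸ α ⊸ α` at `α := B`). [folklore] -/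
def FB : LinTy := .limp 0 tyB (.limp 0 tyB tyB)

/-- `STEP` is sum-free. [folklore] -/
theorem sumFree_STEP : STEP.SumFree := by simp [STEP, I, one, zero, Term.SumFree]

/-- `prog 0` is sum-free. [folklore] -/
theorem sumFree_prog_zero : (prog zero).SumFree := by simp [prog, STEP, I, one, zero, Term.SumFree]

/-- `prog 1` is sum-free. [folklore] -/
theorem sumFree_prog_one : (prog one).SumFree := by simp [prog, STEP, I, one, zero, Term.SumFree]

/-- The context `ℓ : B` (slot `1`). [folklore] -/
def ctxL : Ctx := fun i => if i = 1 then some ⟨0, tyB⟩ else none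

/-- The context `y : B` (slot `0`). [folklore] -/
def ctxY : Ctx := fun i => if i = 0 then some ⟨0, tyB⟩ else none

/-- The context `y : B, ℓ : B` of the body of `STEP`. [folklore] -/
def ctxLY : Ctx := Ctx.cons (some ⟨0, tyB⟩) (Ctx.cons (some ⟨0, tyB⟩) Ctx.empty)

/-- The context `s : S₁` of the body of a program. [folklore] -/
def ctxS : Ctx := Ctx.cons (some ⟨0, tyS 1⟩) Ctx.empty

/-- Trivial split of `ctxL`. [folklore] -/
theorem splitL : ctxL.Split ctxL Ctx.empty := fun _ => Or.inl ⟨rfl, rfl⟩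

/-- Trivial split of `ctxY`. [folklore] -/
theorem splitY : ctxY.Split ctxY Ctx.empty := fun _ => Or.inl ⟨rfl, rfl⟩

/-- Trivial split of `ctxS`. [folklore] -/
theorem splitS : ctxS.Split ctxS Ctx.empty := fun _ => Or.inl ⟨rfl, rfl⟩

/-- `y : B, ℓ : B = (ℓ : B) # (y : B)`. [folklore] -/
theorem splitLY : ctxLY.Split ctxL ctxY := by
  intro i
  rcases i with _ | _ | i
  · exact Or.inr ⟨rfl, rfl⟩
  · exact Or.inl ⟨rfl, rfl⟩
  · exact Or.inl ⟨rfl, rfl⟩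

/-- `ctxL` is the singleton `ℓ : B`. [folklore] -/
theorem single_L : ctxL.IsSingleton 1 ⟨0, tyB⟩ := ⟨rfl, fun j hj => by simp [ctxL, hj]⟩

/-- `ctxY` is the singleton `y : B`. [folklore] -/
theorem single_Y : ctxY.IsSingleton 0 ⟨0, tyB⟩ := ⟨rfl, fun j hj => by simp [ctxY, hj]⟩

/-- `ctxS` is the singleton `s : S₁`. [folklore] -/
theorem single_S : ctxS.IsSingleton 0 ⟨0, tyS 1⟩ :=
  ⟨rfl, fun j hj => by
    rcases j with _ | j
    · exact (hj rfl).elim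
    · rfl⟩

/-- `Ctx.empty = !Ctx.empty`. [folklore] -/
theorem empty_eq_bang : Ctx.empty = Ctx.empty.bang := by funext i; rfl

/-- `⊢ I : B ⊸ B` (the tree's `idD`). [cite: GaboardiMarionRonchidellarocca2008, Table 2] -/
def ID : Deriv 0 Ctx.empty I ⟨0, BB⟩ := Deriv.idD tyB

/-- `ℓ : B ⊢ ℓ : (B⊸B) ⊸ (B⊸B) ⊸ (B⊸B)` by `(Ax)`, `(∀E)`. [cite: GaboardiMarionRonchidellarocca2008, Table 2] -/
def lD : Deriv 0 ctxL (.var 1) ⟨0, .limp 0 BB (.limp 0 BB BB)⟩ := .allE BB (.ax single_L)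

/-- `ℓ : B ⊢ ℓ I I : B ⊸ B`. [cite: GaboardiMarionRonchidellarocca2008, Table 2] -/
def lIID : Deriv 0 ctxL (.app (.app (.var 1) I) I) ⟨0, BB⟩ := .app splitL (.app splitL lD ID) ID

/-- `y : B ⊢ y : B ⊸ B ⊸ B` by `(Ax)`, `(∀E)`. [cite: GaboardiMarionRonchidellarocca2008, Table 2] -/
def yD : Deriv 0 ctxY (.var 0) ⟨0, .limp 0 tyB (.limp 0 tyB tyB)⟩ := .allE tyB (.ax single_Y)

/-- The canonical closed derivation of `0`. [cite: GaboardiMarionRonchidellarocca2008, §3.2] -/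
def zD : Deriv 0 Ctx.empty zero ⟨0, tyB⟩ := Deriv.zeroD Ctx.empty fun _ => rfl

/-- The canonical closed derivation of `1`. [cite: GaboardiMarionRonchidellarocca2008, §3.2] -/
def oD : Deriv 0 Ctx.empty one ⟨0, tyB⟩ := Deriv.oneD Ctx.empty fun _ => rfl

/-- `y : B ⊢ y 1 0 : B` (`= NOT y`). [cite: GaboardiMarionRonchidellarocca2008, Table 2] -/
def y10D : Deriv 0 ctxY (.app (.app (.var 0) one) zero) ⟨0, tyB⟩ := .app splitY (.app splitY yD oD) zD

/-- `y : B, ℓ : B ⊢ ℓ I I (y 1 0) : B`. [cite: GaboardiMarionRonchidellarocca2008, Table 2] -/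
def bodyD : Deriv 0 ctxLY (.app (.app (.app (.var 1) I) I) (.app (.app (.var 0) one) zero)) ⟨0, tyB⟩ :=
  .app splitLY lIID y10D

/-- **`⊢ STEP : B ⊸ B ⊸ B`, degree `0`.** [cite: GaboardiMarionRonchidellarocca2008, Table 2] -/
def STEPD : Deriv 0 Ctx.empty STEP ⟨0, FB⟩ := .lam (.lam bodyD)

/-- `s : S₁ ⊢ s : !(B⊸B⊸B) ⊸ B ⊸ B` by `(Ax)`, `(∀E)` at `α := B`. [cite: GaboardiMarionRonchidellarocca2008, Table 2] -/
def sD : Deriv 0 ctxS (.var 0) ⟨0, .limp 1 FB (.limp 0 tyB tyB)⟩ := .allE tyB (.ax single_S)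

/-- `⊢ STEP : !(B ⊸ B ⊸ B)`, degree `1`, by `(sp)`. [cite: GaboardiMarionRonchidellarocca2008, Table 2 (sp)] -/
def STEPspD : Deriv 1 Ctx.empty STEP ⟨1, FB⟩ := .sp STEPD empty_eq_bang

/-- **`⊢ λs. s STEP b : S₁ ⊸ B = progTy 0 1`, degree `1`** (level `1`: `n = 0` promotions of the word, `m = 1`), for a
closed boolean derivation `Db`. [cite: GaboardiMarionRonchidellarocca2008, Def. 3.8] -/
def progD {b : Term} (Db : Deriv 0 Ctx.empty b ⟨0, tyB⟩) : Deriv 1 Ctx.empty (prog b) (progTy 0 1) :=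
  .lam (.app splitS (.app splitS sD STEPspD) Db)

/-- The typability consequences: `⊢ prog 0 : S₁ ⊸ B` and `⊢ prog 1 : S₁ ⊸ B` with degree `1`. [folklore] -/
theorem typing_prog : Typing 1 Ctx.empty (prog zero) (progTy 0 1) ∧ Typing 1 Ctx.empty (prog one) (progTy 0 1) :=
  ⟨(progD zD).typing, (progD oD).typing⟩

/-- The programs have rank `0` (no multiplexor). [cite: GaboardiMarionRonchidellarocca2008, §3.1] -/
theorem rank_progD {b : Term} (Db : Deriv 0 Ctx.empty b ⟨0, tyB⟩) (hb : Db.rank = 0) : (progD Db).rank = 0 := by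
  simp [progD, sD, STEPspD, STEPD, bodyD, lIID, lD, ID, y10D, yD, zD, oD, Deriv.rank, Deriv.idD, Deriv.zeroD,
    Deriv.oneD, hb]

/-- Hence `⟦prog 0⟧`, `⟦prog 1⟧` are obsessional from threshold `1`. [cite: LaurentTortoraDeFalco2006, Prop. 8] -/
theorem obsessionalFrom_one_prog :
    ObsessionalFrom 1 (SoftProgramInterpretation (progD zD)) ∧ ObsessionalFrom 1 (SoftProgramInterpretation (progD oD)) := by
  have h0 := obsessionalFrom_softProgramInterpretation (progD zD)
  have h1 := obsessionalFrom_softProgramInterpretation (progD oD)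
  rw [rank_progD zD (by simp [zD, Deriv.rank, Deriv.zeroD])] at h0
  rw [rank_progD oD (by simp [oD, Deriv.rank, Deriv.oneD])] at h1
  exact ⟨h0, h1⟩

/-! ## §3 The runs used by the table -/

/-- The empty valuation (runs of closed derivations). [cite: LaurentTortoraDeFalco2006, Def. 12] -/
def noneVal : Val := fun _ => none

/-- Discarding the empty context is the empty valuation. [folklore] -/
theorem discard_empty : Val.discard Ctx.empty = noneVal := by
  funext i; simp [Val.discard, Ctx.empty, noneVal]

/-- Juxtaposing with the empty valuation. [folklore] -/
theorem merge_noneVal (ρ : Val) : Val.merge ρ noneVal = ρ := by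
  funext i; simp only [Val.merge, noneVal]; cases ρ i <;> rfl

/-- Leaving the only binder. [folklore] -/
theorem unshift_single_zero (v : Point) : Val.unshift (Val.single 0 v) = noneVal := by
  funext i; simp [Val.unshift, Val.single, noneVal]

/-- A result of a closed derivation is a run with the empty valuation. [cite: LaurentTortoraDeFalco2006, Def. 12] -/
theorem run_of_result {d : ℕ} {M : Term} {σ : SoftTy} (D : Deriv d Ctx.empty M σ) {p : Point}
    (h : p ∈ SoftProgramInterpretation D) : (noneVal, p) ∈ D.interp :=
  (D.mem_interp_iff_of_closed noneVal p).2 ⟨rfl, h⟩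

/-- The `≤ 1`-box of a closed argument offers one copy `![p]` of every result… [cite: LaurentTortoraDeFalco2006, Def. 12] -/
theorem lift_bang1 {d : ℕ} {M : Term} {σ : SoftTy} (D : Deriv d Ctx.empty M σ) {p : Point}
    (h : p ∈ SoftProgramInterpretation D) : (noneVal, bang1 p) ∈ liftArg 0 Ctx.empty D.interp :=
  Or.inl ⟨noneVal, p, run_of_result D h, rfl⟩

/-- … and the discarded copy `![]`. [cite: LaurentTortoraDeFalco2006, Def. 12] -/
theorem lift_bang0 {d : ℕ} {M : Term} {σ : SoftTy} (D : Deriv d Ctx.empty M σ) :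
    (noneVal, bang0) ∈ liftArg 0 Ctx.empty D.interp :=
  Or.inr (by rw [discard_empty])

/-- `⟦ℓ I I⟧ ∋ (ℓ ↦ ![K̄₁ ⅋ (K̄₂ ⅋ p)], p)` for `K₁, K₂` offered by `I`. [cite: LaurentTortoraDeFalco2006, Def. 12] -/
theorem lII_run {K₁ K₂ : Point} (h₁ : (noneVal, K₁) ∈ liftArg 0 Ctx.empty ID.interp)
    (h₂ : (noneVal, K₂) ∈ liftArg 0 Ctx.empty ID.interp) (p : Point) :
    (Val.single 1 (bang1 ((K₁.dual).par ((K₂.dual).par p))), p) ∈ lIID.interp := by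
  simp only [lIID, lD, Deriv.interp, Set.mem_setOf_eq]
  refine ⟨Val.single 1 (bang1 ((K₁.dual).par ((K₂.dual).par p))), noneVal, K₂, p, ?_, h₂, by rw [merge_noneVal]⟩
  exact ⟨Val.single 1 (bang1 ((K₁.dual).par ((K₂.dual).par p))), noneVal, K₁, (K₂.dual).par p,
    ⟨_, rfl⟩, h₁, by rw [merge_noneVal]⟩

/-- `⟦y 1 0⟧ ∋ (y ↦ ![V̄ ⅋ (W̄ ⅋ q)], q)` for `V` offered by `1`, `W` offered by `0` ("peel").
[cite: LaurentTortoraDeFalco2006, Def. 12] -/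
theorem y10_run {V W : Point} (hV : (noneVal, V) ∈ liftArg 0 Ctx.empty oD.interp)
    (hW : (noneVal, W) ∈ liftArg 0 Ctx.empty zD.interp) (q : Point) :
    (Val.single 0 (bang1 ((V.dual).par ((W.dual).par q))), q) ∈ y10D.interp := by
  simp only [y10D, yD, Deriv.interp, Set.mem_setOf_eq]
  refine ⟨Val.single 0 (bang1 ((V.dual).par ((W.dual).par q))), noneVal, W, q, ?_, hW, by rw [merge_noneVal]⟩
  exact ⟨Val.single 0 (bang1 ((V.dual).par ((W.dual).par q))), noneVal, V, (W.dual).par q,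
    ⟨_, rfl⟩, hV, by rw [merge_noneVal]⟩

/-- The valuation `ℓ ↦ a, y ↦ c` of the body of `STEP`. [folklore] -/
def valLY (a c : Point) : Val := fun i => if i = 0 then some c else if i = 1 then some a else none

/-- Juxtaposition of the two singleton valuations. [folklore] -/
theorem merge_single (a c : Point) : Val.merge (Val.single 1 a) (Val.single 0 c) = valLY a c := by
  funext i
  rcases i with _ | _ | i <;> simp [Val.merge, Val.single, valLY]

/-- Leaving the binder `y`. [folklore] -/
theorem unshift_valLY (a c : Point) : Val.unshift (valLY a c) = Val.single 0 a := by
  funext i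
  rcases i with _ | i <;> simp [Val.unshift, Val.single, valLY]

/-- **A run of `STEP` (strict case):** letter label `![ℓpt]`, `ℓpt = K̄₁ ⅋ (K̄₂ ⅋ (![q]‾ ⅋ r))`; accumulator label
`![ypt]`, `ypt = V̄ ⅋ (W̄ ⅋ q)`; result `r`. [cite: LaurentTortoraDeFalco2006, Def. 12] -/
theorem step_run {K₁ K₂ V W : Point} (h₁ : (noneVal, K₁) ∈ liftArg 0 Ctx.empty ID.interp)
    (h₂ : (noneVal, K₂) ∈ liftArg 0 Ctx.empty ID.interp) (hV : (noneVal, V) ∈ liftArg 0 Ctx.empty oD.interp)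
    (hW : (noneVal, W) ∈ liftArg 0 Ctx.empty zD.interp) (q r : Point) :
    (bang1 ((K₁.dual).par ((K₂.dual).par (((bang1 q).dual).par r)))).dual.par
        ((bang1 ((V.dual).par ((W.dual).par q))).dual.par r) ∈ SoftProgramInterpretation STEPD := by
  set ℓlab := bang1 ((K₁.dual).par ((K₂.dual).par (((bang1 q).dual).par r)))
  set ylab := bang1 ((V.dual).par ((W.dual).par q))
  have hbody : (valLY ℓlab ylab, r) ∈ bodyD.interp := by
    simp only [bodyD, Deriv.interp, Set.mem_setOf_eq]
    refine ⟨Val.single 1 ℓlab, Val.single 0 ylab, bang1 q, r, lII_run h₁ h₂ _, ?_, by rw [merge_single]⟩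
    exact Or.inl ⟨_, q, y10_run hV hW q, rfl⟩
  refine ⟨noneVal, ?_⟩
  simp only [STEPD, Deriv.interp, Set.mem_setOf_eq]
  refine ⟨Val.single 0 ℓlab, (ylab.dual).par r, ℓlab, ?_, by simp [Val.single], ?_⟩
  · exact ⟨valLY ℓlab ylab, r, ylab, hbody, rfl, by rw [unshift_valLY]⟩
  · rw [unshift_single_zero]

/-- `![q]‾ ⅋ q ∈ ⟦I⟧` (the dereliction clique). [cite: LaurentTortoraDeFalco2006, §2.2] -/
theorem derel_mem (q : Point) : ((bang1 q).dual).par q ∈ SoftProgramInterpretation ID := by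
  have h : SoftProgramInterpretation ID = derelictionClique := softProgramInterpretation_idD tyB
  rw [h]
  exact ⟨q, by simp [bang1, Point.dual_ofCourse]⟩

/-- **`STEP` on the letter `0` (`ff`):** letter point `zeroPoint (![r]‾ ⅋ r) ∈ ⟦0⟧`, accumulator one layer around `r`,
result `r`. [cite: LaurentTortoraDeFalco2006, Def. 12] -/
theorem step_run_ff {V W : Point} (hV : (noneVal, V) ∈ liftArg 0 Ctx.empty oD.interp)
    (hW : (noneVal, W) ∈ liftArg 0 Ctx.empty zD.interp) (r : Point) :
    (bang1 (zeroPoint (((bang1 r).dual).par r))).dual.par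
        ((bang1 ((V.dual).par ((W.dual).par r))).dual.par r) ∈ SoftProgramInterpretation STEPD := by
  simpa [zeroPoint] using step_run (lift_bang1 ID (derel_mem r)) (lift_bang0 ID) hV hW r r

/-- **`STEP` on the letter `1` (`tt`).** [cite: LaurentTortoraDeFalco2006, Def. 12] -/
theorem step_run_tt {V W : Point} (hV : (noneVal, V) ∈ liftArg 0 Ctx.empty oD.interp)
    (hW : (noneVal, W) ∈ liftArg 0 Ctx.empty zD.interp) (r : Point) :
    (bang1 (onePoint (((bang1 r).dual).par r))).dual.par
        ((bang1 ((V.dual).par ((W.dual).par r))).dual.par r) ∈ SoftProgramInterpretation STEPD := by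
  simpa [onePoint] using step_run (lift_bang0 ID) (lift_bang1 ID (derel_mem r)) hV hW r r

/-- **Tower step with GENUINE accumulators, letter `ff`:** from `r ∈ ⟦0⟧` the accumulator is `onePoint r ∈ ⟦1⟧`, from
`r ∈ ⟦1⟧` it is `zeroPoint r ∈ ⟦0⟧` — the relational shadow of `NOT`. [cite: LaurentTortoraDeFalco2006, Def. 12] -/
theorem step_tower_ff (r : Point) :
    (r ∈ zeroClique → (bang1 (zeroPoint (((bang1 r).dual).par r))).dual.par ((bang1 (onePoint r)).dual.par r)
      ∈ SoftProgramInterpretation STEPD) ∧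
    (r ∈ oneClique → (bang1 (zeroPoint (((bang1 r).dual).par r))).dual.par ((bang1 (zeroPoint r)).dual.par r)
      ∈ SoftProgramInterpretation STEPD) := by
  refine ⟨fun hr => ?_, fun hr => ?_⟩
  · have hW : (noneVal, bang1 r) ∈ liftArg 0 Ctx.empty zD.interp :=
      lift_bang1 zD (by rw [zD, softProgramInterpretation_zeroD]; exact hr)
    simpa [onePoint] using step_run_ff (lift_bang0 oD) hW r
  · have hV : (noneVal, bang1 r) ∈ liftArg 0 Ctx.empty oD.interp :=
      lift_bang1 oD (by rw [oD, softProgramInterpretation_oneD]; exact hr)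
    simpa [zeroPoint] using step_run_ff hV (lift_bang0 zD) r

/-- **Tower step with genuine accumulators, letter `tt`.** [cite: LaurentTortoraDeFalco2006, Def. 12] -/
theorem step_tower_tt (r : Point) :
    (r ∈ zeroClique → (bang1 (onePoint (((bang1 r).dual).par r))).dual.par ((bang1 (onePoint r)).dual.par r)
      ∈ SoftProgramInterpretation STEPD) ∧
    (r ∈ oneClique → (bang1 (onePoint (((bang1 r).dual).par r))).dual.par ((bang1 (zeroPoint r)).dual.par r)
      ∈ SoftProgramInterpretation STEPD) := by
  refine ⟨fun hr => ?_, fun hr => ?_⟩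
  · have hW : (noneVal, bang1 r) ∈ liftArg 0 Ctx.empty zD.interp :=
      lift_bang1 zD (by rw [zD, softProgramInterpretation_zeroD]; exact hr)
    simpa [onePoint] using step_run_tt (lift_bang0 oD) hW r
  · have hV : (noneVal, bang1 r) ∈ liftArg 0 Ctx.empty oD.interp :=
      lift_bang1 oD (by rw [oD, softProgramInterpretation_oneD]; exact hr)
    simpa [zeroPoint] using step_run_tt hV (lift_bang0 zD) r

/-- **Rows of `⟦λs. s STEP^! b⟧`.** For every finite multiset `M` of labels each of which is `![s]` for a result `s` of
`STEP` or a discarded copy `![]`, every `B₀` offered by `b`, and EVERY point `r`: `![(!M)‾ ⅋ (B̄₀ ⅋ r)]‾ ⅋ r ∈ ⟦prog b⟧`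
— the answer is the free core `r` of the key. [cite: LaurentTortoraDeFalco2006, Def. 12] -/
theorem prog_row_mem {b : Term} (Db : Deriv 0 Ctx.empty b ⟨0, tyB⟩) {M : Multiset Point}
    (hM : ∀ e ∈ M, e = bang0 ∨ ∃ s ∈ SoftProgramInterpretation STEPD, e = bang1 s)
    {B₀ : Point} (hB : (noneVal, B₀) ∈ liftArg 0 Ctx.empty Db.interp) (r : Point) :
    (bang1 (((Point.ofCourse M).dual).par ((B₀.dual).par r))).dual.par r ∈ SoftProgramInterpretation (progD Db) := by
  set a := ((Point.ofCourse M).dual).par ((B₀.dual).par r)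
  have hsp : (noneVal, Point.ofCourse M) ∈ liftArg 1 Ctx.empty STEPspD.interp := by
    show (noneVal, Point.ofCourse M) ∈ STEPspD.interp
    simp only [STEPspD, Deriv.interp, Set.mem_setOf_eq]
    refine ⟨M.map fun e => (noneVal, e), fun x hx => ?_, ?_⟩
    · obtain ⟨e, he, rfl⟩ := Multiset.mem_map.1 hx
      rcases hM e he with rfl | ⟨s, hs, rfl⟩
      · exact lift_bang0 STEPD
      · exact lift_bang1 STEPD hs
    · simp only [Prod.mk.injEq, Multiset.map_map, Function.comp_def, Multiset.map_id']
      refine ⟨?_, trivial⟩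
      funext i
      simp [spVal, Ctx.empty, noneVal]
  have h1 : (Val.single 0 (bang1 a), (B₀.dual).par r) ∈ (Deriv.app splitS sD STEPspD).interp := by
    simp only [sD, Deriv.interp, Set.mem_setOf_eq]
    exact ⟨Val.single 0 (bang1 a), noneVal, Point.ofCourse M, (B₀.dual).par r, ⟨a, rfl⟩, hsp, by rw [merge_noneVal]⟩
  have h2 : (Val.single 0 (bang1 a), r) ∈ (Deriv.app splitS (Deriv.app splitS sD STEPspD) Db).interp := by
    simp only [Deriv.interp, Set.mem_setOf_eq]
    exact ⟨Val.single 0 (bang1 a), noneVal, B₀, r, h1, hB, by rw [merge_noneVal]⟩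
  refine ⟨noneVal, ?_⟩
  simp only [progD, Deriv.interp, Set.mem_setOf_eq]
  exact ⟨Val.single 0 (bang1 a), r, bang1 a, h2, by simp [Val.single], by rw [unshift_single_zero]⟩

end Parity

/-! ## §4 The answer cliques are act-closed (threshold ≥ 1) -/

/-- `(zeroPoint a)ₜ⁽ᵏ⁾ = zeroPoint (a)ₜ⁽ᵏ⁾` for `t ≥ 1`. [cite: LaurentTortoraDeFalco2006, Def. 13] -/
theorem act_zeroPoint {t : ℕ} (ht : 1 ≤ t) (k : ℕ) (a : Point) :
    Point.act t k (zeroPoint a) = zeroPoint (a.act t k) := by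
  simp [zeroPoint, Point.act_par, ← Point.dual_act, act_bang1 ht, act_bang0]

/-- `(onePoint a)ₜ⁽ᵏ⁾ = onePoint (a)ₜ⁽ᵏ⁾` for `t ≥ 1`. [cite: LaurentTortoraDeFalco2006, Def. 13] -/
theorem act_onePoint {t : ℕ} (ht : 1 ≤ t) (k : ℕ) (a : Point) :
    Point.act t k (onePoint a) = onePoint (a.act t k) := by
  simp [onePoint, Point.act_par, ← Point.dual_act, act_bang1 ht, act_bang0]

/-- `⟦0⟧` is `t`-obsessional for every `t ≥ 1`. [cite: LaurentTortoraDeFalco2006, Def. 13] -/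
theorem isObsessional_zeroClique {t : ℕ} (ht : 1 ≤ t) : IsObsessional t zeroClique := by
  rintro _ ⟨a, rfl⟩ k _
  exact ⟨a.act t k, (act_zeroPoint ht k a).symm⟩

/-- `⟦1⟧` is `t`-obsessional for every `t ≥ 1`. [cite: LaurentTortoraDeFalco2006, Def. 13] -/
theorem isObsessional_oneClique {t : ℕ} (ht : 1 ≤ t) : IsObsessional t oneClique := by
  rintro _ ⟨a, rfl⟩ k _
  exact ⟨a.act t k, (act_onePoint ht k a).symm⟩

end Summit.PneNP.PneNP.Theorems.OracleRefusal.Negative
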